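import Summits.CriticalPhenomena.PercolationContinuityZ3.Theorems.PercNearOneGluingNoHeavyLowerTailSahiE3MajPatternRows
import Mathlib.Data.Fintype.Pi
import Mathlib.Data.Fin.VecNotation
import Mathlib.Tactic.Linarith
import Mathlib.Tactic.FinCases
import HarnessLib
import HarnessLib.Audit

/-!
# `NoHeavyLowerTail` (crux stmt-CriticalPhenomena-4575), Sahi programme P4 (Holley / monotone coupling):
# the `1+2+3` slot certificate on the pattern `2³` — combinatorial interface 1: saturated up-sets; pair condition rows

Support file (cell `prim-l12`, seat P4, generation 10; `--supports stmt-CriticalPhenomena-4575`).  No named facts, no sorries;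
standard axioms; def-free; no notation (the slot set is passed as `(M, hM : M = {100, 010, 001, 110, 101, 011, 111})`).

The pattern is `P = Fin 3 → Bool` (patterns of three join-primes `j₀, j₁, j₂`: coordinate `i` records `jᵢ ≤ x`); the slot set is
`OP = 2³ ∖ {000}` = "`x₀ ∨ x₁ ∨ x₂`" (preimage: `↑j₀ ∪ ↑j₁ ∪ ↑j₂`, the hitting pattern `1+2+3`); `ν` is a weight on `P` with point masses `nE` (bottom), `n0, n1, n2` (atoms), `n01, n02, n12` (rank two), `nT` (top) and total
mass `Z` (a symbol: everything is homogeneous of degree three), and `R` retained masses with values `r0, r1, r2, r01, r02, r12, rT` on `OP`.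
All inequality texts are generated from ONE specification (HOME prim-l12-p4/code/gen10/x23) and consumed verbatim across the files
`…SahiE3Hit3Pattern*`, `…SahiE3Hit3Alg*`, `…SahiE3Hit3Core*`, `…SahiE3Hit3Slot`.
* `sat_cases`: an `OP`-saturated up-set of `2³` (an up-set containing every point outside `OP` all of whose `OP`-successors it
  contains — the only up-sets the trace reduction `…SahiE3PatternReduction.pair_of_saturated` needs) is one of 19 explicit sets.
* `pair_row_*`: for each of them as first argument, the pair inequality of `…SahiE3PatternCertificate.phi_nonneg_of_patternCertificate`
  against all second arguments, from the matching items of the canonical 185-item list (up-transport `ut_*`, `total`, `pair_*`).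
  This file: rows `empty`, `UT`, `U01`; the other rows are in `…SahiE3Hit3PatternRows2…4`.
-/

namespace Summit.CriticalPhenomena.PercolationContinuityZ3.Theorems.SahiE3Hit3Pattern

open Finset
open scoped BigOperators

/-- Order facts of the pattern `2³` used below (bottom, top, the comparabilities, and the non-comparabilities between points
outside `OP` and slot points not above them). [folklore] -/
theorem ord_hit3 :
    (∀ x : Fin 3 → Bool, ![false, false, false] ≤ x) ∧
    (∀ x : Fin 3 → Bool, x ≤ ![true, true, true]) ∧
    ![true, false, false] ≤ ![true, true, false] ∧
    ![true, false, false] ≤ ![true, false, true] ∧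
    ![false, true, false] ≤ ![true, true, false] ∧
    ![false, true, false] ≤ ![false, true, true] ∧
    ![false, false, true] ≤ ![true, false, true] ∧
    ![false, false, true] ≤ ![false, true, true] := by
  letI : DecidableLE (Fin 3 → Bool) := fun a b => inferInstanceAs (Decidable (∀ i, a i ≤ b i))
  decide

/-- The `OP`-saturated up-sets of `2³` (`OP = {100, 010, 001, 110, 101, 011, 111}`; an up-set `S` such that an element outside `OP` all of whose `OP`-successors
lie in `S` lies in `S` — the only up-sets the trace reduction `…SahiE3PatternReduction.pair_of_saturated` needs) are exactly the
19 sets listed. [this work] -/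
theorem sat_cases (M : Finset (Fin 3 → Bool))
    (hM : M = {![true, false, false], ![false, true, false], ![false, false, true], ![true, true, false], ![true,
        false, true], ![false, true, true], ![true, true,
        true]}) (S : Finset (Fin 3 → Bool)) (hS : IsUpperSet (S : Set (Fin 3 → Bool)))
    (hsat : ∀ s ∈ Mᶜ, (∀ t ∈ M, s ≤ t → t ∈ S) → s ∈ S) :
    S = ∅ ∨ S = ({![true, true, true]} : Finset (Fin 3 → Bool)) ∨ S = ({![true, true, false], ![true, true,
        true]} : Finset (Fin 3 → Bool)) ∨ S = ({![true, false, true], ![true, true,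
        true]} : Finset (Fin 3 → Bool)) ∨ S = ({![false, true, true], ![true, true,
        true]} : Finset (Fin 3 → Bool)) ∨ S = ({![true, true, false], ![true, false, true], ![true, true,
        true]} : Finset (Fin 3 → Bool)) ∨ S = ({![true, true, false], ![false, true, true], ![true, true,
        true]} : Finset (Fin 3 → Bool)) ∨ S = ({![true, false, true], ![false, true, true], ![true, true,
        true]} : Finset (Fin 3 → Bool)) ∨ S = ({![true, false, false], ![true, true, false], ![true, false, true],
        ![true, true, true]} : Finset (Fin 3 → Bool)) ∨ S = ({![false, true, false], ![true, true, false], ![false,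
        true, true], ![true, true, true]} : Finset (Fin 3 → Bool)) ∨ S = ({![false, false, true], ![true, false,
        true], ![false, true, true], ![true, true, true]} : Finset (Fin 3 → Bool)) ∨ S = ({![true, true, false],
        ![true, false, true], ![false, true, true], ![true, true, true]} : Finset (Fin 3 → Bool)) ∨ S = ({![true,
        false, false], ![true, true, false], ![true, false, true], ![false, true, true], ![true, true,
        true]} : Finset (Fin 3 → Bool)) ∨ S = ({![false, true, false], ![true, true, false], ![true, false, true],
        ![false, true, true], ![true, true, true]} : Finset (Fin 3 → Bool)) ∨ S = ({![false, false, true], ![true,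
        true, false], ![true, false, true], ![false, true, true], ![true, true,
        true]} : Finset (Fin 3 → Bool)) ∨ S = ({![true, false, false], ![false, true, false], ![true, true, false],
        ![true, false, true], ![false, true, true], ![true, true, true]} : Finset (Fin 3 → Bool)) ∨ S = ({![true,
        false, false], ![false, false, true], ![true, true, false], ![true, false, true], ![false, true, true],
        ![true, true, true]} : Finset (Fin 3 → Bool)) ∨ S = ({![false, true, false], ![false, false, true], ![true,
        true, false], ![true, false, true], ![false, true, true], ![true, true,
        true]} : Finset (Fin 3 → Bool)) ∨ S = univ := by
  subst hM
  obtain ⟨hbot, htop, l_0_01, l_0_02, l_1_01, l_1_12, l_2_02, l_2_12⟩ := ord_hit3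
  have up : ∀ {x y : Fin 3 → Bool}, x ≤ y → x ∈ S → y ∈ S := fun hxy hx => hS hxy hx
  have memU : ∀ {t : Fin 3 → Bool}, t ∈ ({![true, false, false], ![false, true, false], ![false, false, true],
      ![true, true, false], ![true, false, true], ![false, true, true], ![true, true,
      true]} : Finset (Fin 3 → Bool)) → t = ![true, false, false] ∨ t = ![false, true, false] ∨ t = ![false, false,
      true] ∨ t = ![true, true, false] ∨ t = ![true, false, true] ∨ t = ![false, true, true] ∨ t = ![true, true,
      true] := by
    intro t h
    simpa only [Finset.mem_insert, Finset.mem_singleton] using h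
  by_cases hb : ![false, false, false] ∈ S
  · refine Or.inr (Or.inr (Or.inr (Or.inr (Or.inr (Or.inr (Or.inr (Or.inr (Or.inr (Or.inr (Or.inr (Or.inr (Or.inr
      (Or.inr (Or.inr (Or.inr (Or.inr (Or.inr (?_))))))))))))))))))
    ext x
    simp only [Finset.mem_univ, iff_true]
    exact up (hbot x) hb
  by_cases cT : ![true, true, true] ∈ S
  swap
  · refine Or.inl ?_
    ext x
    simp only [Finset.notMem_empty, iff_false]
    exact fun hx => cT (up (htop x) hx)
  by_cases c01 : ![true, true, false] ∈ S
  · -- 01 ∈ S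
    by_cases c02 : ![true, false, true] ∈ S
    · -- 02 ∈ S
      by_cases c12 : ![false, true, true] ∈ S
      · -- 12 ∈ S
        by_cases c0 : ![true, false, false] ∈ S
        · -- 0 ∈ S
          by_cases c1 : ![false, true, false] ∈ S
          · -- 1 ∈ S
            by_cases c2 : ![false, false, true] ∈ S
            · -- 2 ∈ S
              exact absurd (hsat _ (by decide) fun t htM _ => by
                  rcases memU htM with rfl | rfl | rfl | rfl | rfl | rfl | rfl
                  exacts [c0, c1, c2, c01, c02, c12, cT]) hb
            · -- 2 ∉ S
              refine Or.inr (Or.inr (Or.inr (Or.inr (Or.inr (Or.inr (Or.inr (Or.inr (Or.inr (Or.inr (Or.inr (Or.inr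
                  (Or.inr (Or.inr (Or.inr (Or.inl ?_)))))))))))))))
              ext x
              rcases SahiE3MajPattern.pts x with rfl | rfl | rfl | rfl | rfl | rfl | rfl | rfl <;> simp [hb, c0, c1,
                  c2, c01, c02, c12, cT]
          · -- 1 ∉ S
            by_cases c2 : ![false, false, true] ∈ S
            · -- 2 ∈ S
              refine Or.inr (Or.inr (Or.inr (Or.inr (Or.inr (Or.inr (Or.inr (Or.inr (Or.inr (Or.inr (Or.inr (Or.inr
                  (Or.inr (Or.inr (Or.inr (Or.inr (Or.inl ?_))))))))))))))))
              ext x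
              rcases SahiE3MajPattern.pts x with rfl | rfl | rfl | rfl | rfl | rfl | rfl | rfl <;> simp [hb, c0, c1,
                  c2, c01, c02, c12, cT]
            · -- 2 ∉ S
              refine Or.inr (Or.inr (Or.inr (Or.inr (Or.inr (Or.inr (Or.inr (Or.inr (Or.inr (Or.inr (Or.inr (Or.inr
                  (Or.inl ?_))))))))))))
              ext x
              rcases SahiE3MajPattern.pts x with rfl | rfl | rfl | rfl | rfl | rfl | rfl | rfl <;> simp [hb, c0, c1,
                  c2, c01, c02, c12, cT]
        · -- 0 ∉ S
          by_cases c1 : ![false, true, false] ∈ S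
          · -- 1 ∈ S
            by_cases c2 : ![false, false, true] ∈ S
            · -- 2 ∈ S
              refine Or.inr (Or.inr (Or.inr (Or.inr (Or.inr (Or.inr (Or.inr (Or.inr (Or.inr (Or.inr (Or.inr (Or.inr
                  (Or.inr (Or.inr (Or.inr (Or.inr (Or.inr (Or.inl ?_)))))))))))))))))
              ext x
              rcases SahiE3MajPattern.pts x with rfl | rfl | rfl | rfl | rfl | rfl | rfl | rfl <;> simp [hb, c0, c1,
                  c2, c01, c02, c12, cT]
            · -- 2 ∉ S
              refine Or.inr (Or.inr (Or.inr (Or.inr (Or.inr (Or.inr (Or.inr (Or.inr (Or.inr (Or.inr (Or.inr (Or.inr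
                  (Or.inr (Or.inl ?_)))))))))))))
              ext x
              rcases SahiE3MajPattern.pts x with rfl | rfl | rfl | rfl | rfl | rfl | rfl | rfl <;> simp [hb, c0, c1,
                  c2, c01, c02, c12, cT]
          · -- 1 ∉ S
            by_cases c2 : ![false, false, true] ∈ S
            · -- 2 ∈ S
              refine Or.inr (Or.inr (Or.inr (Or.inr (Or.inr (Or.inr (Or.inr (Or.inr (Or.inr (Or.inr (Or.inr (Or.inr
                  (Or.inr (Or.inr (Or.inl ?_))))))))))))))
              ext x
              rcases SahiE3MajPattern.pts x with rfl | rfl | rfl | rfl | rfl | rfl | rfl | rfl <;> simp [hb, c0, c1,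
                  c2, c01, c02, c12, cT]
            · -- 2 ∉ S
              refine Or.inr (Or.inr (Or.inr (Or.inr (Or.inr (Or.inr (Or.inr (Or.inr (Or.inr (Or.inr (Or.inr (Or.inl
                  ?_)))))))))))
              ext x
              rcases SahiE3MajPattern.pts x with rfl | rfl | rfl | rfl | rfl | rfl | rfl | rfl <;> simp [hb, c0, c1,
                  c2, c01, c02, c12, cT]
      · -- 12 ∉ S
        by_cases c0 : ![true, false, false] ∈ S
        · -- 0 ∈ S
          have c1 : ![false, true, false] ∉ S := fun h => c12 (up l_1_12 h)
          have c2 : ![false, false, true] ∉ S := fun h => c12 (up l_2_12 h)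
          refine Or.inr (Or.inr (Or.inr (Or.inr (Or.inr (Or.inr (Or.inr (Or.inr (Or.inl ?_))))))))
          ext x
          rcases SahiE3MajPattern.pts x with rfl | rfl | rfl | rfl | rfl | rfl | rfl | rfl <;> simp [hb, c0, c1, c2,
              c01, c02, c12, cT]
        · -- 0 ∉ S
          have c1 : ![false, true, false] ∉ S := fun h => c12 (up l_1_12 h)
          have c2 : ![false, false, true] ∉ S := fun h => c12 (up l_2_12 h)
          refine Or.inr (Or.inr (Or.inr (Or.inr (Or.inr (Or.inl ?_)))))
          ext x
          rcases SahiE3MajPattern.pts x with rfl | rfl | rfl | rfl | rfl | rfl | rfl | rfl <;> simp [hb, c0, c1, c2,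
              c01, c02, c12, cT]
    · -- 02 ∉ S
      by_cases c12 : ![false, true, true] ∈ S
      · -- 12 ∈ S
        have c0 : ![true, false, false] ∉ S := fun h => c02 (up l_0_02 h)
        by_cases c1 : ![false, true, false] ∈ S
        · -- 1 ∈ S
          have c2 : ![false, false, true] ∉ S := fun h => c02 (up l_2_02 h)
          refine Or.inr (Or.inr (Or.inr (Or.inr (Or.inr (Or.inr (Or.inr (Or.inr (Or.inr (Or.inl ?_)))))))))
          ext x
          rcases SahiE3MajPattern.pts x with rfl | rfl | rfl | rfl | rfl | rfl | rfl | rfl <;> simp [hb, c0, c1, c2,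
              c01, c02, c12, cT]
        · -- 1 ∉ S
          have c2 : ![false, false, true] ∉ S := fun h => c02 (up l_2_02 h)
          refine Or.inr (Or.inr (Or.inr (Or.inr (Or.inr (Or.inr (Or.inl ?_))))))
          ext x
          rcases SahiE3MajPattern.pts x with rfl | rfl | rfl | rfl | rfl | rfl | rfl | rfl <;> simp [hb, c0, c1, c2,
              c01, c02, c12, cT]
      · -- 12 ∉ S
        have c0 : ![true, false, false] ∉ S := fun h => c02 (up l_0_02 h)
        have c1 : ![false, true, false] ∉ S := fun h => c12 (up l_1_12 h)
        have c2 : ![false, false, true] ∉ S := fun h => c02 (up l_2_02 h)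
        refine Or.inr (Or.inr (Or.inl ?_))
        ext x
        rcases SahiE3MajPattern.pts x with rfl | rfl | rfl | rfl | rfl | rfl | rfl | rfl <;> simp [hb, c0, c1, c2,
            c01, c02, c12, cT]
  · -- 01 ∉ S
    by_cases c02 : ![true, false, true] ∈ S
    · -- 02 ∈ S
      by_cases c12 : ![false, true, true] ∈ S
      · -- 12 ∈ S
        have c0 : ![true, false, false] ∉ S := fun h => c01 (up l_0_01 h)
        have c1 : ![false, true, false] ∉ S := fun h => c01 (up l_1_01 h)
        by_cases c2 : ![false, false, true] ∈ S
        · -- 2 ∈ S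
          refine Or.inr (Or.inr (Or.inr (Or.inr (Or.inr (Or.inr (Or.inr (Or.inr (Or.inr (Or.inr (Or.inl ?_))))))))))
          ext x
          rcases SahiE3MajPattern.pts x with rfl | rfl | rfl | rfl | rfl | rfl | rfl | rfl <;> simp [hb, c0, c1, c2,
              c01, c02, c12, cT]
        · -- 2 ∉ S
          refine Or.inr (Or.inr (Or.inr (Or.inr (Or.inr (Or.inr (Or.inr (Or.inl ?_)))))))
          ext x
          rcases SahiE3MajPattern.pts x with rfl | rfl | rfl | rfl | rfl | rfl | rfl | rfl <;> simp [hb, c0, c1, c2,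
              c01, c02, c12, cT]
      · -- 12 ∉ S
        have c0 : ![true, false, false] ∉ S := fun h => c01 (up l_0_01 h)
        have c1 : ![false, true, false] ∉ S := fun h => c01 (up l_1_01 h)
        have c2 : ![false, false, true] ∉ S := fun h => c12 (up l_2_12 h)
        refine Or.inr (Or.inr (Or.inr (Or.inl ?_)))
        ext x
        rcases SahiE3MajPattern.pts x with rfl | rfl | rfl | rfl | rfl | rfl | rfl | rfl <;> simp [hb, c0, c1, c2,
            c01, c02, c12, cT]
    · -- 02 ∉ S
      by_cases c12 : ![false, true, true] ∈ S
      · -- 12 ∈ S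
        have c0 : ![true, false, false] ∉ S := fun h => c01 (up l_0_01 h)
        have c1 : ![false, true, false] ∉ S := fun h => c01 (up l_1_01 h)
        have c2 : ![false, false, true] ∉ S := fun h => c02 (up l_2_02 h)
        refine Or.inr (Or.inr (Or.inr (Or.inr (Or.inl ?_))))
        ext x
        rcases SahiE3MajPattern.pts x with rfl | rfl | rfl | rfl | rfl | rfl | rfl | rfl <;> simp [hb, c0, c1, c2,
            c01, c02, c12, cT]
      · -- 12 ∉ S
        have c0 : ![true, false, false] ∉ S := fun h => c01 (up l_0_01 h)
        have c1 : ![false, true, false] ∉ S := fun h => c01 (up l_1_01 h)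
        have c2 : ![false, false, true] ∉ S := fun h => c02 (up l_2_02 h)
        refine Or.inr (Or.inl ?_)
        ext x
        rcases SahiE3MajPattern.pts x with rfl | rfl | rfl | rfl | rfl | rfl | rfl | rfl <;> simp [hb, c0, c1, c2,
            c01, c02, c12, cT]

/-- Row `S = empty` of the pair condition: the 19 saturated `S'` (see `pair_all`). [this work] -/
theorem pair_row_empty (M : Finset (Fin 3 → Bool))
    (hM : M = {![true, false, false], ![false, true, false], ![false, false, true], ![true, true, false], ![true,
        false, true], ![false, true, true], ![true, true,
        true]}) (ν : (Fin 3 → Bool) → ℝ) (n0 n1 n2 n01 n02 n12 nT Z : ℝ)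
    (hZ : ∑ t, ν t = Z) (h0 : ν ![true, false, false] = n0) (h1 : ν ![false, true, false] = n1) (h2 : ν ![false,
        false, true] = n2) (h01 : ν ![true, true, false] = n01) (h02 : ν ![true, false,
        true] = n02) (h12 : ν ![false, true, true] = n12) (hT : ν ![true, true, true] = nT)
    (R : (Fin 3 → Bool) → ℝ) 
    (S' : Finset (Fin 3 → Bool)) (hS' : IsUpperSet (S' : Set (Fin 3 → Bool)))
    (hsS' : ∀ s ∈ Mᶜ, (∀ t ∈ M, s ≤ t → t ∈ S') → s ∈ S') :
    Z * ((∑ t ∈ (∅ : Finset (Fin 3 → Bool)), ν t) * (∑ t ∈ S' ∩ M, ν t)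
        + (∑ t ∈ S', ν t) * (∑ t ∈ (∅ : Finset (Fin 3 → Bool)) ∩ M, ν t))
        - (n0 + n1 + n2 + n01 + n02 + n12 + nT) * (∑ t ∈ (∅ : Finset (Fin 3 → Bool)), ν t) * (∑ t ∈ S', ν t)
      ≤ ∑ t ∈ ((∅ : Finset (Fin 3 → Bool)) ∩ S') ∩ M, R t := by
  subst hM
  rcases sat_cases _ rfl S' hS' hsS' with rfl | rfl | rfl | rfl | rfl | rfl | rfl | rfl | rfl | rfl | rfl | rfl | rfl
      | rfl | rfl | rfl | rfl | rfl | rfl <;>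
  · simp (disch := decide) only [Finset.empty_inter, Finset.inter_empty, Finset.univ_inter, Finset.inter_univ,
      Finset.insert_inter_of_mem, Finset.singleton_inter_of_mem,
      Finset.sum_empty, Finset.sum_singleton, Finset.sum_insert, hZ,
      h0, h1, h2, h01, h02, h12, hT]
    linarith

/-- Row `S = UT` of the pair condition: the 19 saturated `S'` (see `pair_all`). [this work] -/
theorem pair_row_UT (M : Finset (Fin 3 → Bool))
    (hM : M = {![true, false, false], ![false, true, false], ![false, false, true], ![true, true, false], ![true,
        false, true], ![false, true, true], ![true, true,
        true]}) (ν : (Fin 3 → Bool) → ℝ) (n0 n1 n2 n01 n02 n12 nT Z : ℝ)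
    (hZ : ∑ t, ν t = Z) (h0 : ν ![true, false, false] = n0) (h1 : ν ![false, true, false] = n1) (h2 : ν ![false,
        false, true] = n2) (h01 : ν ![true, true, false] = n01) (h02 : ν ![true, false,
        true] = n02) (h12 : ν ![false, true, true] = n12) (hT : ν ![true, true, true] = nT) (rT : ℝ)
    (R : (Fin 3 → Bool) → ℝ) (hRT : R ![true, true, true] = rT)
    (nU mU01 mU02 mU12 mU01_02 mU01_12 mU02_12 mU0 mU1 mU2 mU01_02_12 mU0_12 mU1_02 mU2_01 mU0_1 mU0_2 mU1_2 : ℝ)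
        (hnU : (n0 + n1 + n2 + n01 + n02 + n12 + nT) = nU) (hmU01 : (n01 + nT) = mU01) (hmU02 : (n02 +
        nT) = mU02) (hmU12 : (n12 + nT) = mU12) (hmU01_02 : (n01 + n02 + nT) = mU01_02) (hmU01_12 : (n01 + n12 +
        nT) = mU01_12) (hmU02_12 : (n02 + n12 + nT) = mU02_12) (hmU0 : (n0 + n01 + n02 + nT) = mU0) (hmU1 : (n1 +
        n01 + n12 + nT) = mU1) (hmU2 : (n2 + n02 + n12 + nT) = mU2) (hmU01_02_12 : (n01 + n02 + n12 +
        nT) = mU01_02_12) (hmU0_12 : (n0 + n01 + n02 + n12 + nT) = mU0_12) (hmU1_02 : (n1 + n01 + n02 + n12 +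
        nT) = mU1_02) (hmU2_01 : (n2 + n01 + n02 + n12 + nT) = mU2_01) (hmU0_1 : (n0 + n1 + n01 + n02 + n12 +
        nT) = mU0_1) (hmU0_2 : (n0 + n2 + n01 + n02 + n12 + nT) = mU0_2) (hmU1_2 : (n1 + n2 + n01 + n02 + n12 +
        nT) = mU1_2)
    (h_pair_UT__UT : Z * (nT * nT + nT * nT) - nU * nT * nT ≤ rT)
    (h_pair_UT__U01 : Z * (nT * mU01 + mU01 * nT) - nU * nT * mU01 ≤ rT)
    (h_pair_UT__U02 : Z * (nT * mU02 + mU02 * nT) - nU * nT * mU02 ≤ rT)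
    (h_pair_UT__U12 : Z * (nT * mU12 + mU12 * nT) - nU * nT * mU12 ≤ rT)
    (h_pair_UT__U01_02 : Z * (nT * mU01_02 + mU01_02 * nT) - nU * nT * mU01_02 ≤ rT)
    (h_pair_UT__U01_12 : Z * (nT * mU01_12 + mU01_12 * nT) - nU * nT * mU01_12 ≤ rT)
    (h_pair_UT__U02_12 : Z * (nT * mU02_12 + mU02_12 * nT) - nU * nT * mU02_12 ≤ rT)
    (h_pair_UT__U0 : Z * (nT * mU0 + mU0 * nT) - nU * nT * mU0 ≤ rT)
    (h_pair_UT__U1 : Z * (nT * mU1 + mU1 * nT) - nU * nT * mU1 ≤ rT)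
    (h_pair_UT__U2 : Z * (nT * mU2 + mU2 * nT) - nU * nT * mU2 ≤ rT)
    (h_pair_UT__U01_02_12 : Z * (nT * mU01_02_12 + mU01_02_12 * nT) - nU * nT * mU01_02_12 ≤ rT)
    (h_pair_UT__U0_12 : Z * (nT * mU0_12 + mU0_12 * nT) - nU * nT * mU0_12 ≤ rT)
    (h_pair_UT__U1_02 : Z * (nT * mU1_02 + mU1_02 * nT) - nU * nT * mU1_02 ≤ rT)
    (h_pair_UT__U2_01 : Z * (nT * mU2_01 + mU2_01 * nT) - nU * nT * mU2_01 ≤ rT)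
    (h_pair_UT__U0_1 : Z * (nT * mU0_1 + mU0_1 * nT) - nU * nT * mU0_1 ≤ rT)
    (h_pair_UT__U0_2 : Z * (nT * mU0_2 + mU0_2 * nT) - nU * nT * mU0_2 ≤ rT)
    (h_pair_UT__U1_2 : Z * (nT * mU1_2 + mU1_2 * nT) - nU * nT * mU1_2 ≤ rT)
    (h_ut_UT : Z * Z * nT ≤ rT)
    (S' : Finset (Fin 3 → Bool)) (hS' : IsUpperSet (S' : Set (Fin 3 → Bool)))
    (hsS' : ∀ s ∈ Mᶜ, (∀ t ∈ M, s ≤ t → t ∈ S') → s ∈ S') :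
    Z * ((∑ t ∈ ({![true, true, true]} : Finset (Fin 3 → Bool)), ν t) * (∑ t ∈ S' ∩ M, ν t)
        + (∑ t ∈ S', ν t) * (∑ t ∈ ({![true, true, true]} : Finset (Fin 3 → Bool)) ∩ M, ν t))
        - (n0 + n1 + n2 + n01 + n02 + n12 + nT) * (∑ t ∈ ({![true, true, true]} : Finset (Fin 3 → Bool)),
            ν t) * (∑ t ∈ S', ν t)
      ≤ ∑ t ∈ (({![true, true, true]} : Finset (Fin 3 → Bool)) ∩ S') ∩ M, R t := by
  subst hM
  subst hnU hmU01 hmU02 hmU12 hmU01_02 hmU01_12 hmU02_12 hmU0 hmU1 hmU2 hmU01_02_12 hmU0_12 hmU1_02 hmU2_01 hmU0_1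
      hmU0_2 hmU1_2
  rcases sat_cases _ rfl S' hS' hsS' with rfl | rfl | rfl | rfl | rfl | rfl | rfl | rfl | rfl | rfl | rfl | rfl | rfl
      | rfl | rfl | rfl | rfl | rfl | rfl <;>
  · simp (disch := decide) only [Finset.empty_inter, Finset.inter_empty, Finset.univ_inter, Finset.inter_univ,
      Finset.insert_inter_of_mem, Finset.singleton_inter_of_mem,
      Finset.sum_empty, Finset.sum_singleton, Finset.sum_insert, hZ,
      hRT, h0, h1, h2, h01, h02, h12, hT]
    linarith

/-- Row `S = U01` of the pair condition: the 19 saturated `S'` (see `pair_all`). [this work] -/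
theorem pair_row_U01 (M : Finset (Fin 3 → Bool))
    (hM : M = {![true, false, false], ![false, true, false], ![false, false, true], ![true, true, false], ![true,
        false, true], ![false, true, true], ![true, true,
        true]}) (ν : (Fin 3 → Bool) → ℝ) (n0 n1 n2 n01 n02 n12 nT Z : ℝ)
    (hZ : ∑ t, ν t = Z) (h0 : ν ![true, false, false] = n0) (h1 : ν ![false, true, false] = n1) (h2 : ν ![false,
        false, true] = n2) (h01 : ν ![true, true, false] = n01) (h02 : ν ![true, false,
        true] = n02) (h12 : ν ![false, true, true] = n12) (hT : ν ![true, true, true] = nT) (r01 rT : ℝ)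
    (R : (Fin 3 → Bool) → ℝ) (hR01 : R ![true, true, false] = r01) (hRT : R ![true, true, true] = rT)
    (nU mU01 mU02 mU12 mU01_02 mU01_12 mU02_12 mU0 mU1 mU2 mU01_02_12 mU0_12 mU1_02 mU2_01 mU0_1 mU0_2 mU1_2 : ℝ)
        (hnU : (n0 + n1 + n2 + n01 + n02 + n12 + nT) = nU) (hmU01 : (n01 + nT) = mU01) (hmU02 : (n02 +
        nT) = mU02) (hmU12 : (n12 + nT) = mU12) (hmU01_02 : (n01 + n02 + nT) = mU01_02) (hmU01_12 : (n01 + n12 +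
        nT) = mU01_12) (hmU02_12 : (n02 + n12 + nT) = mU02_12) (hmU0 : (n0 + n01 + n02 + nT) = mU0) (hmU1 : (n1 +
        n01 + n12 + nT) = mU1) (hmU2 : (n2 + n02 + n12 + nT) = mU2) (hmU01_02_12 : (n01 + n02 + n12 +
        nT) = mU01_02_12) (hmU0_12 : (n0 + n01 + n02 + n12 + nT) = mU0_12) (hmU1_02 : (n1 + n01 + n02 + n12 +
        nT) = mU1_02) (hmU2_01 : (n2 + n01 + n02 + n12 + nT) = mU2_01) (hmU0_1 : (n0 + n1 + n01 + n02 + n12 +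
        nT) = mU0_1) (hmU0_2 : (n0 + n2 + n01 + n02 + n12 + nT) = mU0_2) (hmU1_2 : (n1 + n2 + n01 + n02 + n12 +
        nT) = mU1_2)
    (h_pair_UT__U01 : Z * (nT * mU01 + mU01 * nT) - nU * nT * mU01 ≤ rT)
    (h_pair_U01__U01 : Z * (mU01 * mU01 + mU01 * mU01) - nU * mU01 * mU01 ≤ r01 + rT)
    (h_pair_U01__U02 : Z * (mU01 * mU02 + mU02 * mU01) - nU * mU01 * mU02 ≤ rT)
    (h_pair_U01__U12 : Z * (mU01 * mU12 + mU12 * mU01) - nU * mU01 * mU12 ≤ rT)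
    (h_pair_U01__U01_02 : Z * (mU01 * mU01_02 + mU01_02 * mU01) - nU * mU01 * mU01_02 ≤ r01 + rT)
    (h_pair_U01__U01_12 : Z * (mU01 * mU01_12 + mU01_12 * mU01) - nU * mU01 * mU01_12 ≤ r01 + rT)
    (h_pair_U01__U02_12 : Z * (mU01 * mU02_12 + mU02_12 * mU01) - nU * mU01 * mU02_12 ≤ rT)
    (h_pair_U01__U0 : Z * (mU01 * mU0 + mU0 * mU01) - nU * mU01 * mU0 ≤ r01 + rT)
    (h_pair_U01__U1 : Z * (mU01 * mU1 + mU1 * mU01) - nU * mU01 * mU1 ≤ r01 + rT)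
    (h_pair_U01__U2 : Z * (mU01 * mU2 + mU2 * mU01) - nU * mU01 * mU2 ≤ rT)
    (h_pair_U01__U01_02_12 : Z * (mU01 * mU01_02_12 + mU01_02_12 * mU01) - nU * mU01 * mU01_02_12 ≤ r01 + rT)
    (h_pair_U01__U0_12 : Z * (mU01 * mU0_12 + mU0_12 * mU01) - nU * mU01 * mU0_12 ≤ r01 + rT)
    (h_pair_U01__U1_02 : Z * (mU01 * mU1_02 + mU1_02 * mU01) - nU * mU01 * mU1_02 ≤ r01 + rT)
    (h_pair_U01__U2_01 : Z * (mU01 * mU2_01 + mU2_01 * mU01) - nU * mU01 * mU2_01 ≤ r01 + rT)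
    (h_pair_U01__U0_1 : Z * (mU01 * mU0_1 + mU0_1 * mU01) - nU * mU01 * mU0_1 ≤ r01 + rT)
    (h_pair_U01__U0_2 : Z * (mU01 * mU0_2 + mU0_2 * mU01) - nU * mU01 * mU0_2 ≤ r01 + rT)
    (h_pair_U01__U1_2 : Z * (mU01 * mU1_2 + mU1_2 * mU01) - nU * mU01 * mU1_2 ≤ r01 + rT)
    (h_ut_U01 : Z * Z * mU01 ≤ r01 + rT)
    (S' : Finset (Fin 3 → Bool)) (hS' : IsUpperSet (S' : Set (Fin 3 → Bool)))
    (hsS' : ∀ s ∈ Mᶜ, (∀ t ∈ M, s ≤ t → t ∈ S') → s ∈ S') :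
    Z * ((∑ t ∈ ({![true, true, false], ![true, true, true]} : Finset (Fin 3 → Bool)), ν t) * (∑ t ∈ S' ∩ M, ν t)
        + (∑ t ∈ S', ν t) * (∑ t ∈ ({![true, true, false], ![true, true, true]} : Finset (Fin 3 → Bool)) ∩ M, ν t))
        - (n0 + n1 + n2 + n01 + n02 + n12 + nT) * (∑ t ∈ ({![true, true, false], ![true, true,
            true]} : Finset (Fin 3 → Bool)), ν t) * (∑ t ∈ S', ν t)
      ≤ ∑ t ∈ (({![true, true, false], ![true, true, true]} : Finset (Fin 3 → Bool)) ∩ S') ∩ M, R t := by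
  subst hM
  subst hnU hmU01 hmU02 hmU12 hmU01_02 hmU01_12 hmU02_12 hmU0 hmU1 hmU2 hmU01_02_12 hmU0_12 hmU1_02 hmU2_01 hmU0_1
      hmU0_2 hmU1_2
  rcases sat_cases _ rfl S' hS' hsS' with rfl | rfl | rfl | rfl | rfl | rfl | rfl | rfl | rfl | rfl | rfl | rfl | rfl
      | rfl | rfl | rfl | rfl | rfl | rfl <;>
  · simp (disch := decide) only [Finset.empty_inter, Finset.inter_empty, Finset.univ_inter, Finset.inter_univ,
      Finset.insert_inter_of_mem, Finset.insert_inter_of_notMem, Finset.singleton_inter_of_mem,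
      Finset.sum_empty, Finset.sum_singleton, Finset.sum_insert, hZ,
      hR01, hRT, h0, h1, h2, h01, h02, h12, hT]
    linarith

end Summit.CriticalPhenomena.PercolationContinuityZ3.Theorems.SahiE3Hit3Pattern
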